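import Mathlib
import HarnessLib
import Literature.Probability.LatticeModels.BrillouinRiemannSum
import Literature.MathematicalPhysics.QuantumLattice.HubbardFreeCovariance
import Literature.MathematicalPhysics.QuantumLattice.HubbardFreePropagator
import Literature.MathematicalPhysics.QuantumLattice.FejerTopCutoff
import Summits.HubbardSuperconductivity.HubbardSuperconductivity.Theorems.KLProgrammeKLRegimeTwoPointAssemblyIntTools

/-!
# Child `KLRegimeTwoPointAssemblyV7` of crux K3 (stmt-HubbardSuperconductivity-19666), line `asm-repr` —
# the MATSUBARA–RIEMANN DOUBLE LIMIT, part 1: frequency tails, grid Riemann sums, the limit integrals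
# (analytic core of the stub `stub_asm_int`; seat hubbard-kl-k3c5-p1)

Model-free analysis.  For every cutoff pair `(L, M)` let `f L M : FreqMomentum L M → ℂ` be a function on the
`2M` Matsubara frequencies `ω = π(2n+1)/β`, `n ∈ [-M, M)`, times the momentum grid `(2π/L)(ℤ/Lℤ)²` (in the application:
`e^{ip·(x−y)} ĝ_K(ω,p)² Σ̂_{L,M}((ω,p),σ)`, the summand of `reprInt`).  Assume

* (H1) a summable frequency tail, uniformly in the volume: `‖f L M (ω,q)‖ ≤ C/ω²` for `L ≥ L₀`, `M ≥ M⋆(L)`;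
* (H2) grid convergence at each fixed Matsubara integer `n` to a continuous function of the momentum, in the iterated sense
  `∀ ε, ∃ L₁, ∀ L ≥ L₁, ∃ M₁, ∀ M ≥ M₁`: `‖f L M (ω_n, q) − φ_n(p_q)‖ ≤ ε` for all `q` (`p_q = 2πq/L`)
  — exactly the two clauses of the volume-limit slot `FinalTwoLegVolLimit`.

This file (with `Σ_n (2n+1)⁻² < ∞` from `…TwoPointAssemblyIntTools`): momentum sums over the grid `p_q = 2πq/L` are `(2π)⁻²` times the
corner Riemann sums of `BrillouinRiemannSum` (`sum_latticeMomentum_eq_cornerRiemannSum`); and the limit integrals obey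
`‖∫_{[-π,π]²} φ_n(p+π) dp‖ ≤ (2π)² C/ω_n²` — read off the Riemann sums themselves, no density argument —
(`norm_integral_brillouin_le_of_grid`), hence are summable over `n ∈ ℤ` (`summable_integral_brillouin_of_grid`).
The double limit itself is `…MatsubaraRiemannLimit`.  Everything is PROVED; no definition, nothing about the model.

References: G. Benfatto, A. Giuliani, V. Mastropietro, Ann. Henri Poincaré 7 (2006) 809, §2 (finite-volume momentum and
frequency sums → integrals); S. Friedli, Y. Velenik, *Statistical Mechanics of Lattice Systems* (2017) §10.5.2.
-/

noncomputable section

namespace Summit.HubbardSuperconductivity.HubbardSuperconductivity.Theorems.TwoPointAssembly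

set_option linter.dupNamespace false -- summit = problem name (single-conjunct summit), D-0017

open Filter Topology Finset MeasureTheory Literature.MathematicalPhysics.QuantumLattice Literature.Probability.LatticeModels

/-! ### §1 Matsubara labels and frequencies -/

/-- Every integer `n ∈ [-M, M)` is the label of a Matsubara index. -/
theorem exists_matsubaraInt_eq_of_le_of_lt {M : ℕ} {n : ℤ} (h1 : -(M : ℤ) ≤ n) (h2 : n < M) :
    ∃ i : MatsubaraIdx M, matsubaraInt M i = n := by
  refine ⟨⟨(n + M).toNat, ?_⟩, ?_⟩
  · have : (n + M).toNat < 2 * M := by omega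
    exact this
  · simp only [matsubaraInt]
    rw [Int.toNat_of_nonneg (by omega)]
    ring

/-! ### §2 Momentum sums over the grid are corner Riemann sums -/

section Grid

variable {E : Type*} [NormedAddCommGroup E] [NormedSpace ℝ E]

/-- `L⁻² Σ_{q ∈ (ℤ/Lℤ)²} G(p_q) = (2π)⁻² · cornerRiemannSum (G(· + π)) L` (`p_q = 2πq/L = c_q + π`). -/
theorem sum_latticeMomentum_eq_cornerRiemannSum (G : (Fin 2 → ℝ) → E) (L : ℕ) [NeZero L] :
    ((L : ℝ) ^ 2)⁻¹ • ∑ q : TorusSite 2 L, G (latticeMomentum L q) =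
      ((2 * Real.pi) ^ 2)⁻¹ • cornerRiemannSum (fun p => G (p + fun _ => Real.pi)) L := by
  rw [cornerRiemannSum_eq, ← Finset.smul_sum, smul_smul]
  have hL : (L : ℝ) ≠ 0 := by exact_mod_cast NeZero.ne L
  have hstep : ((2 * Real.pi) ^ 2)⁻¹ * gridStep L ^ 2 = ((L : ℝ) ^ 2)⁻¹ := by
    rw [gridStep]
    field_simp
  rw [hstep]
  congr 1
  refine Finset.sum_congr rfl fun q _ => ?_
  rw [latticeMomentum_eq_cellCorner_add]

/-- Norm bound for a grid momentum sum: if `‖G(p_q)‖ ≤ B` for every `q`, then `‖L⁻² Σ_q G(p_q)‖ ≤ B`. -/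
theorem norm_sum_latticeMomentum_le {G : (Fin 2 → ℝ) → E} {L : ℕ} [NeZero L] {B : ℝ}
    (h : ∀ q : TorusSite 2 L, ‖G (latticeMomentum L q)‖ ≤ B) :
    ‖((L : ℝ) ^ 2)⁻¹ • ∑ q : TorusSite 2 L, G (latticeMomentum L q)‖ ≤ B := by
  have hL : (0 : ℝ) < (L : ℝ) ^ 2 := by
    have : (0 : ℝ) < L := by exact_mod_cast Nat.pos_of_ne_zero (NeZero.ne L)
    positivity
  have hcard : (Fintype.card (TorusSite 2 L) : ℝ) = (L : ℝ) ^ 2 := by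
    rw [card_torusSite]; push_cast; ring
  rw [norm_smul, norm_inv, Real.norm_of_nonneg hL.le]
  calc ((L : ℝ) ^ 2)⁻¹ * ‖∑ q : TorusSite 2 L, G (latticeMomentum L q)‖
      ≤ ((L : ℝ) ^ 2)⁻¹ * ∑ q : TorusSite 2 L, B := by
        gcongr
        exact (norm_sum_le _ _).trans (Finset.sum_le_sum fun q _ => h q)
    _ = B := by
        rw [Finset.sum_const, Finset.card_univ, nsmul_eq_mul, hcard, ← mul_assoc, inv_mul_cancel₀ hL.ne', one_mul]


/-- The Matsubara frequency of an index with integer label `n` is `π(2n+1)/β`. -/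
theorem matsubaraFreq_eq_of_matsubaraInt_eq {β : ℝ} {M : ℕ} {i : MatsubaraIdx M} {n : ℤ} (h : matsubaraInt M i = n) :
    matsubaraFreq β M i = Real.pi * (2 * (n : ℝ) + 1) / β := by
  rw [matsubaraFreq, h]

/-- `C/ω_n² = (Cβ²/π²)·(2n+1)⁻²` for `ω_n = π(2n+1)/β`. -/
theorem div_omega_sq_eq (β C : ℝ) (n : ℤ) :
    C / (Real.pi * (2 * (n : ℝ) + 1) / β) ^ 2 = C * β ^ 2 / Real.pi ^ 2 * (1 / (2 * (n : ℝ) + 1) ^ 2) := by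
  by_cases hβ : β = 0
  · subst hβ; simp
  by_cases hodd : (2 * (n : ℝ) + 1) = 0
  · rw [hodd]; simp
  field_simp

end Grid

/-! ### §3 The Brillouin integrals of the limit functions: `|∫ φ_n| ≤ (2π)² C/ω_n²`, summable over `n` -/

section PerInteger

variable {β : ℝ} (f : (L M : ℕ) → FreqMomentum L M → ℂ) (φ : ℤ → (Fin 2 → ℝ) → ℂ) {C : ℝ} {L₀ : ℕ} {Mstar : ℕ → ℕ}

/-- **Bound of the limit integrals through the Riemann sums.**  Under (H1) (tail domination `C/ω²`) and (H2) (grid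
convergence at the integer `n` to the continuous `φ_n`), `‖∫_{[-π,π]²} φ_n(p + π) dp‖ ≤ (2π)² · C/ω_n²`: at the grid points
`φ_n` is within `ε` of `f`, which is bounded by `C/ω_n²`, and the corner Riemann sums converge to the integral. -/
theorem norm_integral_brillouin_le_of_grid (hφ : ∀ n, Continuous (φ n))
    (hdom : ∀ (L : ℕ) [NeZero L], L₀ ≤ L → ∀ M : ℕ, Mstar L ≤ M → ∀ k : FreqMomentum L M,
      ‖f L M k‖ ≤ C / (matsubaraFreq β M k.1) ^ 2)
    (hconv : ∀ (n : ℤ) (ε : ℝ), 0 < ε → ∃ L₁ : ℕ, ∀ (L : ℕ) [NeZero L], L₁ ≤ L → ∃ M₁ : ℕ, ∀ M : ℕ, M₁ ≤ M →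
      ∀ k : FreqMomentum L M, matsubaraInt M k.1 = n → ‖f L M k - φ n (latticeMomentum L k.2)‖ ≤ ε)
    (n : ℤ) :
    ‖∫ p in brillouin 2, φ n (p + fun _ => Real.pi)‖ ≤
      (2 * Real.pi) ^ 2 * (C / (Real.pi * (2 * (n : ℝ) + 1) / β) ^ 2) := by
  set ωn : ℝ := Real.pi * (2 * (n : ℝ) + 1) / β with hωn
  set G : (Fin 2 → ℝ) → ℂ := fun p => φ n (p + fun _ => Real.pi) with hG
  have hGc : Continuous G := (hφ n).comp (continuous_id.add continuous_const)
  have hR : Tendsto (cornerRiemannSum G) atTop (𝓝 (∫ p in brillouin 2, G p)) :=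
    tendsto_cornerRiemannSum hGc.continuousOn
  have h2π : (0 : ℝ) < (2 * Real.pi) ^ 2 := by positivity
  refine le_of_forall_pos_le_add fun ε hε => ?_
  -- tolerance `ε' = ε/(2π)²` in (H2)
  obtain ⟨L₁, hL₁⟩ := hconv n (ε / (2 * Real.pi) ^ 2) (by positivity)
  -- eventually in `L` the Riemann sum is bounded
  have hev : ∀ᶠ L : ℕ in atTop, ‖cornerRiemannSum G L‖ ≤ (2 * Real.pi) ^ 2 * (C / ωn ^ 2 + ε / (2 * Real.pi) ^ 2) := by
    filter_upwards [eventually_ge_atTop (max L₁ (max L₀ 1))] with L hL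
    have hL1 : 1 ≤ L := le_trans (le_trans (le_max_right _ _) (le_max_right _ _)) hL
    haveI : NeZero L := ⟨by omega⟩
    have hLL₀ : L₀ ≤ L := le_trans (le_trans (le_max_left _ _) (le_max_right _ _)) hL
    have hLL₁ : L₁ ≤ L := le_trans (le_max_left _ _) hL
    obtain ⟨M₁, hM₁⟩ := hL₁ L hLL₁
    set M : ℕ := max M₁ (max (Mstar L) (n.natAbs + 1)) with hM
    have hMM₁ : M₁ ≤ M := le_max_left _ _
    have hMs : Mstar L ≤ M := le_trans (le_max_left _ _) (le_max_right _ _)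
    have hMn : n.natAbs + 1 ≤ M := le_trans (le_max_right _ _) (le_max_right _ _)
    obtain ⟨i, hi⟩ := exists_matsubaraInt_eq_of_le_of_lt (M := M) (n := n) (by omega) (by omega)
    -- pointwise bound at the grid points
    have hpt : ∀ q : TorusSite 2 L, ‖φ n (latticeMomentum L q)‖ ≤ C / ωn ^ 2 + ε / (2 * Real.pi) ^ 2 := by
      intro q
      have h1 := hdom L hLL₀ M hMs (i, q)
      have h2 := hM₁ M hMM₁ (i, q) hi
      rw [matsubaraFreq_eq_of_matsubaraInt_eq hi] at h1
      calc ‖φ n (latticeMomentum L q)‖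
          = ‖f L M (i, q) - (f L M (i, q) - φ n (latticeMomentum L q))‖ := by rw [sub_sub_cancel]
        _ ≤ ‖f L M (i, q)‖ + ‖f L M (i, q) - φ n (latticeMomentum L q)‖ := norm_sub_le _ _
        _ ≤ C / ωn ^ 2 + ε / (2 * Real.pi) ^ 2 := add_le_add h1 h2
    have hsum := norm_sum_latticeMomentum_le (G := φ n) hpt
    have heq : cornerRiemannSum G L = ((2 * Real.pi) ^ 2) • (((L : ℝ) ^ 2)⁻¹ • ∑ q : TorusSite 2 L, φ n (latticeMomentum L q)) := by
      rw [sum_latticeMomentum_eq_cornerRiemannSum (φ n) L, smul_smul, mul_inv_cancel₀ h2π.ne', one_smul]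
    rw [heq, norm_smul, Real.norm_of_nonneg h2π.le]
    exact mul_le_mul_of_nonneg_left hsum h2π.le
  have hlim := le_of_tendsto hR.norm hev
  calc ‖∫ p in brillouin 2, G p‖ ≤ (2 * Real.pi) ^ 2 * (C / ωn ^ 2 + ε / (2 * Real.pi) ^ 2) := hlim
    _ = (2 * Real.pi) ^ 2 * (C / ωn ^ 2) + ε := by field_simp

/-- **The limit integrals are summable over the Matsubara integers** (comparison with `Σ_n (2n+1)⁻²`). -/
theorem summable_integral_brillouin_of_grid (hφ : ∀ n, Continuous (φ n))
    (hdom : ∀ (L : ℕ) [NeZero L], L₀ ≤ L → ∀ M : ℕ, Mstar L ≤ M → ∀ k : FreqMomentum L M,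
      ‖f L M k‖ ≤ C / (matsubaraFreq β M k.1) ^ 2)
    (hconv : ∀ (n : ℤ) (ε : ℝ), 0 < ε → ∃ L₁ : ℕ, ∀ (L : ℕ) [NeZero L], L₁ ≤ L → ∃ M₁ : ℕ, ∀ M : ℕ, M₁ ≤ M →
      ∀ k : FreqMomentum L M, matsubaraInt M k.1 = n → ‖f L M k - φ n (latticeMomentum L k.2)‖ ≤ ε) :
    Summable fun n : ℤ => ∫ p in brillouin 2, φ n (p + fun _ => Real.pi) := by
  refine Summable.of_norm_bounded
    (g := fun n : ℤ => (2 * Real.pi) ^ 2 * (C * β ^ 2 / Real.pi ^ 2) * (1 / (2 * (n : ℝ) + 1) ^ 2))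
    (summable_one_div_two_mul_add_one_sq.mul_left _) fun n => ?_
  have h := norm_integral_brillouin_le_of_grid f φ hφ hdom hconv n
  rw [div_omega_sq_eq] at h
  simpa only [mul_assoc] using h

end PerInteger

end Summit.HubbardSuperconductivity.HubbardSuperconductivity.Theorems.TwoPointAssembly

end
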